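import Literature.NumberTheory.EllipticCurves.KodairaNeronMultiplicativeProofs
import Literature.NumberTheory.EllipticCurves.HasseWeilAbelianEulerFactorKodairaNeronProofs
import Literature.NumberTheory.EllipticCurves.InertiaInvariantsMultiplicativeProofs
import HarnessLib

/-!
# Serre–Tate's Lemma 2 at a split multiplicative place for the whole decomposition group:
# discharge of `serreTate_smul_torsion_of_hasSplitMultiplicativeReductionAt`, and the surjection
# `Gal(K̄_v/K_v) ↠ D_𝔓` (Neukirch II (9.6))

`Proofs` file (theorems only, no definitions, no named facts) in topic
`NumberTheory/EllipticCurves`, sibling of `HasseWeilAbelianEulerFactorTorsion` and of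
`HasseWeilAbelianEulerFactorTorsionProofs`.  It **discharges the named fact**
`WeierstrassCurve.serreTate_smul_torsion_of_hasSplitMultiplicativeReductionAt W ℓ`
(`HasseWeilAbelianEulerFactorTorsion`): *for an elliptic curve `E/K` over a number field with split
multiplicative reduction at the finite place `v ∤ ℓ` and a prime `𝔓 ∣ v` of `\bar ℤ_K`, there is
`c ≠ 0` with `σ(cP) = (χ_ℓ(σ) mod ℓⁿ)(cP)` for every `σ` in the decomposition group `D_𝔓`, every
`n` and every `I_𝔓`-fixed `P ∈ E(K̄)` with `ℓⁿ P = O`* — Serre–Tate, *Good reduction of abelian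
varieties*, §1 Lemma 2 (*"The reduction map defines an isomorphism of `A_m^I` onto `Ã_m`.  This
isomorphism commutes with the action of `D(v̄)`"*) with Lemma 1 (`c • Ã_m ⊆ Ã⁰_m`) and the split
torus `Ã⁰ = Ẽ_ns ≅ 𝔾_m` over `k_v` (Silverman, *AEC*, Exercise 3.5(a)(i)); equivalently Silverman,
*ATAEC*, Exercise 5.13(a),(b) (PDF p. 416): `T_ℓ(E)^{I} = T_ℓ(μ)` as a `G_{K̄_v/K_v}`-module.
This is the torsion-point (integral) form, for **every** element of `D_𝔓`, of the statements
`smul_fixedSubmodule_inertia_rationalTate_of_hasSplitMultiplicativeReductionAt` /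
`inertiaCoinvariants_rationalTate_of_hasSplitMultiplicativeReductionAt` on `V_ℓ E`, which the tree
proves in `HasseWeilAbelianEulerFactorEllipticSplitProofs` from the Frobenius elements by Frobenius
generation of `D_𝔓/I_𝔓` and continuity; they also follow from the present theorem by
`smul_fixedSubmodule_inertia_rationalTate_of_hasSplitMultiplicativeReductionAt_of_torsion`
(`HasseWeilAbelianEulerFactorTorsion`).

## The proof

Exactly as the Frobenius-only form
`smul_nsmul_torsion_of_hasMultiplicativeReductionAt_of_kodairaNeron_primeBelow`
(`HasseWeilAbelianEulerFactorKodairaNeronProofs`), inside `K̄_v` with its spectral valuation `w`: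
the minimal model, its `𝒪_w`-model `W₀`, the presented node `singularModel x₀ y₀ α₁ α₂` over the
residue field `k(𝒪_w)`, the explicit reduction map `r = ψ ∘ reduction : E₀ → k(𝒪_w)ˣ` with kernel
`E₁` (no `ℓ`-torsion), the transport `E(K̄) → W₀(K̄_v)` along an embedding `ι`,
`A' = E(K̄)^{I_𝔓} ∩ (transport)⁻¹(E₀)`, the exponent `c` from Kodaira–Néron — a theorem at the
multiplicative places (`kodairaNeron_exists_finset_reducesToNonsingular_of_hasMultiplicativeReductionAt`,
`KodairaNeronMultiplicativeProofs`) — and the residue map `φ : \bar ℤ_K/𝔓 ↪ k(𝒪_w)`.  The one new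
input is **the surjectivity of the local Galois group onto the decomposition group** (Neukirch,
*ANT*, II (9.6): `G(L_w|K_v) ≅ G_w(L|K)`), here
`Literature.NumberTheory.EllipticCurves.exists_absoluteGaloisGroup_apply_eq_of_smul_primeBelow_eq`:
every `τ ∈ Γ_K` with `τ 𝔓_{ι,𝔐} = 𝔓_{ι,𝔐}` is the restriction along `ι` of some `σ ∈ Γ_{K_v}` —
proved like the inertia case `exists_mem_inertia_apply_eq_holds'` (`SelmerInertiaProofs`): `τ` is
an isometry of `‖ι ·‖_v` (`spectralNorm_apply_smul_eq`), extends to `Γ_{K_v}` on every `K(α)`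
(`exists_absoluteGaloisGroup_smul_apply_eq`), and `Γ_{K_v}` is compact with continuous restriction
`resGalOfEmb ι`, so its image is closed and contains `τ`.  Given `σ ∈ D_𝔓`, its local lift `σ_v`
is a `w`-isometry (`spectralValuation_smul`), acts on `r` through its residue endomorphism `σ̄_v`
(`exists_residueMap_nodeReduction_smul`), which fixes `k_v`, hence — the split polynomial of
Mathlib's `HasSplitMultiplicativeReduction` having its roots in `k_v` — fixes the tangent slopes
(`apply_slopes_eq_of_splits`), so `r` is `σ`-equivariant and the datum-shape theorem
`smul_nsmul_eq_cyclotomicCharacter_smul_of_reduction` (`HasseWeilAbelianEulerFactorTorsionProofs`: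
roots of unity of `k(𝒪_w)` come from `\bar ℤ_K`, on which `σ` acts through `χ_ℓ`) concludes.

## Main results

* `Literature.NumberTheory.EllipticCurves.exists_absoluteGaloisGroup_apply_eq_of_smul_primeBelow_eq`
  (`Γ_{K_v} ↠ D_{𝔓_{ι,𝔐}}` along `ι`, Neukirch II (9.6));
* `WeierstrassCurve.smul_nsmul_torsion_of_hasSplitMultiplicativeReductionAt_primeBelow`, `…_at`;
* `WeierstrassCurve.serreTate_smul_torsion_of_hasSplitMultiplicativeReductionAt_holds`
  (**the discharge**).

## References

* J.-P. Serre, J. Tate, *Good reduction of abelian varieties*, Ann. of Math. (2) 88 (1968),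
  §1 Lemma 1, Lemma 2 (p. 495). [SerreTate1968]
* J. H. Silverman, *Advanced Topics in the Arithmetic of Elliptic Curves*, GTM 151 (1994):
  Exercise 5.13(a),(b) (PDF p. 416). [SilvermanATAEC1994]
* J. H. Silverman, *The Arithmetic of Elliptic Curves*, 2nd ed. (2009): Exercise 3.5(a)(i),
  Prop. VII.2.1, Thm. VII.6.1 (PDF pp. 97, 167, 177). [SilvermanAEC2009]
* J. Neukirch, *Algebraic Number Theory* (1999), Ch. II §9, Prop. (9.6) and its proof.
  [NeukirchANT1999]

## Design

Theorems only; `noncomputable section`; `open scoped Classical NNReal Pointwise`; one universe `u`;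
`set_option maxHeartbeats 1600000` and `synthInstance.maxHeartbeats 200000` for the core proof, as
in `HasseWeilAbelianEulerFactorKodairaNeronProofs`, whose construction of the reduction datum is
repeated verbatim (imports: those of `HasseWeilAbelianEulerFactorHoldsProofs`).  The lift lemma
lives in `Literature.NumberTheory.EllipticCurves` next to `exists_mem_inertia_apply_eq_holds'`; the
elliptic-curve statements are deliberate dot-notation extensions of Mathlib's `WeierstrassCurve`
namespace.  All axioms `propext`, `Classical.choice`, `Quot.sound`.
-/

noncomputable section

open scoped Classical NNReal Pointwise

universe u

/-! ## The local Galois group surjects onto the decomposition group (Neukirch II (9.6)) -/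

namespace Literature.NumberTheory.EllipticCurves

open NumberField IsDedekindDomain Polynomial Field
open scoped IntermediateField

variable {K : Type u} [Field K] [NumberField K] {v : HeightOneSpectrum (𝓞 K)}

/-- **The local Galois group surjects onto the decomposition group** (Neukirch, *Algebraic
Number Theory*, Ch. II §9, Prop. (9.6): for `L|K` Galois and `w ∣ v` the restriction
`G(L_w|K_v) → G_w(L|K)` is an isomorphism onto the decomposition group
`G_w = {σ : w ∘ σ = w}`; here `L = K̄`, `w` the valuation of the prime `𝔓_{ι,𝔐}` of `\bar ℤ_K` cut
out by a `K`-embedding `ι : K̄ → K̄_v` and the prime `𝔐` of `\bar 𝓞_v` above `𝓂_v`).  Every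
`τ ∈ Γ_K` stabilising `𝔓_{ι,𝔐}` is the restriction along `ι` of some `σ ∈ Γ_{K_v} = Gal(K̄_v/K_v)`:
`ι (τ x) = σ (ι x)` for all `x ∈ K̄`.  Proof as for the inertia groups
(`exists_mem_inertia_apply_eq_holds'`, whose steps are reused): `τ` is an isometry of `‖ι ·‖_v`
(`spectralNorm_apply_smul_eq`: the two absolute values `‖ι ·‖`, `‖ι τ ·‖` on each `K(x)` cut out
the same prime); on each finite `K(α) ⊆ K̄` it extends by continuity to an element of `Γ_{K_v}`
(`exists_absoluteGaloisGroup_smul_apply_eq`); `Γ_{K_v}` is compact and restriction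
`resGalOfEmb ι : Γ_{K_v} → Γ_K` is continuous, so its image is closed, and it meets every
neighbourhood of `τ`. [cite: NeukirchANT1999, Ch. II §9 Prop. (9.6)] -/
theorem exists_absoluteGaloisGroup_apply_eq_of_smul_primeBelow_eq
    (ι : AlgebraicClosure K →ₐ[K] AlgebraicClosure (v.adicCompletion K))
    {𝔐 : Ideal (HeightOneSpectrum.localAbsIntegers v)} (h𝔐 : 𝔐 ∈ v.localPrimesAbove)
    {τ : absoluteGaloisGroup K} (hτ : τ • v.primeBelow ι 𝔐 = v.primeBelow ι 𝔐) :
    ∃ σ : absoluteGaloisGroup (v.adicCompletion K),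
      ∀ x : AlgebraicClosure K, ι (τ • x) = σ • ι x := by
  haveI := h𝔐.1
  haveI := h𝔐.2
  haveI : CharZero (v.adicCompletion K) :=
    charZero_of_injective_algebraMap (algebraMap K (v.adicCompletion K)).injective
  -- Step 1: `τ` is an isometry of `‖ι ·‖_v`
  have hmem : ∀ b : GaloisRepresentations.absIntegers (𝓞 K) K,
      b ∈ v.primeBelow ι 𝔐 ↔
        spectralNorm (v.adicCompletion K) (AlgebraicClosure (v.adicCompletion K)) (ι b) < 1 :=
    fun b ↦ by
    rw [HeightOneSpectrum.mem_primeBelow_iff,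
      GaloisRepresentations.mem_iff_spectralNorm_lt_one_adicCompletion v,
      HeightOneSpectrum.coe_absIntegersToLocal_apply]
  have hiso : ∀ x, spectralNorm (v.adicCompletion K) (AlgebraicClosure (v.adicCompletion K))
      (ι (τ • x)) = spectralNorm (v.adicCompletion K) (AlgebraicClosure (v.adicCompletion K))
        (ι x) := by
    refine spectralNorm_apply_smul_eq ι τ fun b hb ↦ ?_
    have h1 := hmem ⟨b, hb⟩
    have h2 := hmem (τ • (⟨b, hb⟩ : GaloisRepresentations.absIntegers (𝓞 K) K))
    have h3 : τ • (⟨b, hb⟩ : GaloisRepresentations.absIntegers (𝓞 K) K) ∈ v.primeBelow ι 𝔐 ↔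
        (⟨b, hb⟩ : GaloisRepresentations.absIntegers (𝓞 K) K) ∈ v.primeBelow ι 𝔐 := by
      conv_lhs => rw [← hτ]
      exact Ideal.smul_mem_pointwise_smul_iff
    exact (h1.symm.trans h3.symm).trans h2
  -- Step 2: the closure argument
  set res := resGalOfEmb ι with hres
  have hcl : IsClosed (Set.range res) := (isCompact_range res.continuous_toFun).isClosed
  suffices hmemc : τ ∈ closure (Set.range res) by
    rw [hcl.closure_eq] at hmemc
    obtain ⟨σ, hστ⟩ := hmemc
    refine ⟨σ, fun x ↦ ?_⟩
    have h := apply_resGalAuxOfEmb_apply ι σ x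
    rw [← resGalOfEmb_apply, ← hres, hστ] at h
    exact h
  rw [mem_closure_iff_nhds]
  intro t ht
  -- a basic neighbourhood `τ • Gal(K̄/E)`, `E/K` finite, inside `t`
  have ht1 : (fun g ↦ τ * g) ⁻¹' t ∈ nhds (1 : absoluteGaloisGroup K) := by
    refine (continuous_const_mul τ).continuousAt.preimage_mem_nhds ?_
    rwa [mul_one]
  obtain ⟨E, hEfd, -, hEt⟩ :=
    (krullTopology_mem_nhds_one_iff_of_normal K (AlgebraicClosure K) _).mp ht1
  obtain ⟨α, rfl⟩ := exists_eq_adjoin_simple E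
  obtain ⟨σ, hσ⟩ := exists_absoluteGaloisGroup_smul_apply_eq ι τ hiso α
  refine ⟨res σ, ?_, σ, rfl⟩
  -- `τ⁻¹ * res σ` fixes `K(α)`
  have hfix : absoluteGaloisGroup.toAlgEquiv K (τ⁻¹ * res σ) ∈ K⟮α⟯.fixingSubgroup := by
    rw [IntermediateField.mem_fixingSubgroup_iff]
    intro x hx
    obtain ⟨p, rfl⟩ :=
      (mem_adjoin_simple_iff_exists_aeval (Algebra.IsIntegral.isIntegral α)).mp hx
    change (τ⁻¹ * res σ) • aeval α p = aeval α p
    rw [mul_smul, inv_smul_eq_iff]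
    apply ι.injective
    have h := apply_resGalAuxOfEmb_apply ι σ (aeval α p)
    rw [← resGalOfEmb_apply] at h
    exact h.trans (hσ p)
  have h : τ * (τ⁻¹ * res σ) ∈ t := hEt hfix
  rwa [mul_inv_cancel_left] at h

end Literature.NumberTheory.EllipticCurves

/-! ## Serre–Tate's Lemma 2 at a split multiplicative place, on torsion points, for `D_𝔓` -/

namespace WeierstrassCurve

open NumberField IsDedekindDomain
open Literature.NumberTheory.EllipticCurves Literature.NumberTheory.GaloisRepresentations Field
  IsDedekindDomain.HeightOneSpectrum

variable {K : Type u} [Field K] [NumberField K] {v : HeightOneSpectrum (𝓞 K)}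
  (W : WeierstrassCurve K) (ℓ : ℕ) [Fact ℓ.Prime]

set_option maxHeartbeats 1600000 in
set_option synthInstance.maxHeartbeats 200000 in
/-- **Serre–Tate's Lemma 2 at a split multiplicative place, on torsion points, for the whole
decomposition group — at the prime cut out by an embedding.**  Let `E/K` be elliptic, `ℓ` a
prime, `v ∤ ℓ` a place of split multiplicative reduction, `ι : K̄ → K̄_v` a `K`-embedding and `𝔐`
the prime of `\bar 𝓞_v` above `𝓂_v`, `𝔓 = 𝔓_{ι,𝔐}`.  There is `c ≠ 0` such that for every `σ` in
the decomposition group `D_𝔓`, every `n` and every `I_𝔓`-fixed `P ∈ E(K̄)` with `ℓⁿ P = O`: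
**`σ(cP) = (χ_ℓ(σ) mod ℓⁿ) • (cP)`.**  Proof: the reduction datum of
`smul_nsmul_torsion_of_hasMultiplicativeReductionAt_of_kodairaNeron_primeBelow`
(`A' = E₀ ∩ E(K̄)^{I_𝔓}` inside `K̄_v`, `c` from Kodaira–Néron — a theorem at the multiplicative
places, `kodairaNeron_exists_finset_reducesToNonsingular_of_hasMultiplicativeReductionAt` —, the
explicit node map `r = ψ ∘ reduction` with kernel `E₁` without `ℓ`-torsion, the residue map
`φ : \bar ℤ_K/𝔓 ↪ k(𝒪_w)`); `σ` lifts to `σ_v ∈ Γ_{K_v}`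
(`exists_absoluteGaloisGroup_apply_eq_of_smul_primeBelow_eq`, Neukirch II (9.6)), a `w`-isometry
acting on `r` through its residue endomorphism `σ̄_v` (`exists_residueMap_nodeReduction_smul`),
which fixes `k_v` and hence, the reduction being split, the tangent slopes
(`apply_slopes_eq_of_splits`): `r` is `σ`-equivariant, and
`smul_nsmul_eq_cyclotomicCharacter_smul_of_reduction` concludes (`σ` acts on `μ_{ℓⁿ}(\bar ℤ_K)`
through `χ_ℓ mod ℓⁿ`).  Serre–Tate §1 Lemmas 1–2; Silverman, *AEC*, Exercise 3.5(a)(i), VII.2.1,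
VII.3.1, VII.6.1; *ATAEC* Exercise 5.13(a),(b).
[cite: SerreTate1968, §1 Lemma 1 and Lemma 2 (p. 495)]
[cite: SilvermanAEC2009, Exercise 3.5(a)(i), Prop. VII.2.1, Thm. VII.6.1 (PDF pp. 97, 167, 177)]
[cite: SilvermanATAEC1994, Exercise 5.13(a),(b) (PDF p. 416)] -/
theorem smul_nsmul_torsion_of_hasSplitMultiplicativeReductionAt_primeBelow [W.IsElliptic]
    (hℓ : (ℓ : 𝓞 K) ∉ v.asIdeal) (hv : W.HasSplitMultiplicativeReductionAt v)
    (ι : AlgebraicClosure K →ₐ[K] AlgebraicClosure (v.adicCompletion K))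
    {𝔐 : Ideal v.localAbsIntegers} (h𝔐 : 𝔐 ∈ v.localPrimesAbove) :
    ∃ c : ℕ, c ≠ 0 ∧
      ∀ (σ : (v.primeBelow ι 𝔐).decompositionSubgroup (absoluteGaloisGroup K)) (n : ℕ)
        (P : geomPoints W),
        (∀ τ ∈ (v.primeBelow ι 𝔐).inertia (absoluteGaloisGroup K), τ • P = P) → ℓ ^ n • P = 0 →
        (σ : absoluteGaloisGroup K) • (c • P) =
          (((GaloisRep.cyclotomicCharacter K ℓ (σ : absoluteGaloisGroup K) : ℤ_[ℓ]ˣ) :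
            ℤ_[ℓ]).toZModPow n).val • (c • P) := by
  obtain ⟨w, hw⟩ := v.exists_spectralValuation
  have hv0 : w.Integers w.integer := Valuation.integer.integers w
  haveI := henselianRing_integer w
  haveI := isAlgClosed_residueField_integer w
  -- ### models: `X = W_min`, its integral model `I` over `𝓞_v`, the `𝒪_w`-model `W₀`
  haveI : (W.localMinimalModel v).IsElliptic := W.isElliptic_localMinimalModel v
  have hsplit' : (W.localMinimalModel v).HasSplitMultiplicativeReduction
      (v.adicCompletionIntegers K) := hv
  have hmult' : (W.localMinimalModel v).HasMultiplicativeReduction (v.adicCompletionIntegers K) :=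
    hsplit'.toHasMultiplicativeReduction
  have hmult : W.HasMultiplicativeReductionAt v := hmult'
  have hIX : ((W.localMinimalModel v).integralModel (v.adicCompletionIntegers K)).map
      (algebraMap (v.adicCompletionIntegers K) (v.adicCompletion K)) = W.localMinimalModel v :=
    baseChange_integralModel_eq (v.adicCompletionIntegers K) (W.localMinimalModel v)
  have hint : ((W.localMinimalModel v).baseChange (AlgebraicClosure (v.adicCompletion K))).IsIntegral
      w.integer := by
    have := isIntegral_spectralValuation_baseChange hw
      ((W.localMinimalModel v).integralModel (v.adicCompletionIntegers K))
    rwa [hIX] at this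
  haveI := hint
  obtain ⟨W₀, hW₀⟩ := hint.integral
  set I := (W.localMinimalModel v).integralModel (v.adicCompletionIntegers K) with hIdef
  -- `W₀` has the coefficients of `I`
  have hW₀I : W₀.map (algebraMap w.integer (AlgebraicClosure (v.adicCompletion K))) =
      I.map ((algebraMap (v.adicCompletion K) (AlgebraicClosure (v.adicCompletion K))).comp
        (algebraMap (v.adicCompletionIntegers K) (v.adicCompletion K))) := by
    rw [← map_map, hIX]
    exact hW₀.symm
  have hle : ∀ a : v.adicCompletionIntegers K,
      w (algebraMap (v.adicCompletion K) (AlgebraicClosure (v.adicCompletion K))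
        (algebraMap (v.adicCompletionIntegers K) (v.adicCompletion K) a)) ≤ 1 :=
    fun a ↦ (spectralValuation_algebraMap_le_one_iff hw _).mpr a.2
  -- ### the reduction of `W₀` is a node; present it
  have hΔ : IsLocalRing.residue w.integer W₀.Δ = 0 := by
    have hlt := hmult'.badReduction
    rw [← integralModel_Δ_eq (v.adicCompletionIntegers K) (W.localMinimalModel v)] at hlt
    have hmem := (IsDedekindDomain.HeightOneSpectrum.valuation_lt_one_iff_mem _ _).mp hlt
    rw [← v_algebraMap_lt_one_iff hv0]
    have hΔeq : algebraMap w.integer (AlgebraicClosure (v.adicCompletion K)) W₀.Δ =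
        algebraMap (v.adicCompletion K) (AlgebraicClosure (v.adicCompletion K))
          (algebraMap (v.adicCompletionIntegers K) (v.adicCompletion K) I.Δ) := by
      rw [← map_Δ, hW₀I, map_Δ]; rfl
    rw [hΔeq]
    exact spectralValuation_algebraMap_lt_one_of_mem_maximalIdeal hw h𝔐 hmem
  have hc₄not : I.c₄ ∉ IsLocalRing.maximalIdeal (v.adicCompletionIntegers K) := fun hmem ↦ by
    have heq := hmult'.multiplicativeReduction
    rw [← integralModel_c₄_eq (v.adicCompletionIntegers K) (W.localMinimalModel v)] at heq
    have := (IsDedekindDomain.HeightOneSpectrum.valuation_lt_one_iff_mem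
      (K := v.adicCompletion K)
      (IsDiscreteValuationRing.maximalIdeal (v.adicCompletionIntegers K)) _).mpr hmem
    rw [heq] at this
    exact lt_irrefl _ this
  have hc₄O : IsLocalRing.residue (v.adicCompletionIntegers K) I.c₄ ≠ 0 := fun h0 ↦
    hc₄not ((IsLocalRing.residue_eq_zero_iff _).mp h0)
  have hc₄ : IsLocalRing.residue w.integer W₀.c₄ ≠ 0 := by
    have hunit : IsUnit I.c₄ := by
      by_contra hu
      exact hc₄not ((IsLocalRing.mem_maximalIdeal _).mpr hu)
    rw [← v_algebraMap_eq_one_iff hv0]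
    have hc₄eq : algebraMap w.integer (AlgebraicClosure (v.adicCompletion K)) W₀.c₄ =
        algebraMap (v.adicCompletion K) (AlgebraicClosure (v.adicCompletion K))
          (algebraMap (v.adicCompletionIntegers K) (v.adicCompletion K) I.c₄) := by
      rw [← map_c₄, hW₀I, map_c₄]; rfl
    rw [hc₄eq]
    exact spectralValuation_eq_one_of_isUnit hw hunit
  set V := W₀.map (IsLocalRing.residue w.integer) with hVdef
  have hVΔ : V.Δ = 0 := by rw [hVdef, map_Δ, hΔ]
  have hVc₄ : V.c₄ ≠ 0 := by rw [hVdef, map_c₄]; exact hc₄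
  obtain ⟨x₀, y₀, hE, hX, hY⟩ := V.exists_singularPoint hVΔ
  obtain ⟨α₁, α₂, hs, hp⟩ := V.exists_tangentSlopes x₀
  have hV : W₀.map (IsLocalRing.residue w.integer) = singularModel x₀ y₀ α₁ α₂ :=
    V.eq_singularModel hE hX hY hs hp
  have hα : α₁ ≠ α₂ := fun h ↦ hVc₄ (by
    change (W₀.map (IsLocalRing.residue w.integer)).c₄ = 0
    rw [hV, singularModel.c₄_eq, h, sub_self, zero_pow four_ne_zero])
  -- the explicit reduction map onto the torus
  obtain ⟨r, hr0, hrf⟩ := W₀.exists_addMonoidHom_units_of_map_eq_singularModel hv0 hV hα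
  -- ### transport and the Kodaira–Néron exponent (a theorem at the multiplicative places)
  obtain ⟨C, hC⟩ := W.exists_variableChange_smul_eq_localMinimalModel v
  obtain ⟨Φ, hΦ⟩ := W.exists_addEquiv_localPoints_of_smul_eq v hC
  obtain ⟨c, hc, hcE₀⟩ := exists_nsmul_hasNonsingularReduction_of_kodairaNeron
    (W.kodairaNeron_exists_finset_reducesToNonsingular_of_hasMultiplicativeReductionAt hmult)
    hw h𝔐 hW₀
  -- ### the residue field of `𝓞_v` inside `k(𝒪_w)`
  obtain ⟨j, hj, -, -⟩ := v.exists_residueFieldMap_adicCompletionIntegers hw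
  -- the reduced integral model, pushed into the residue field of `𝒪_w`, is the presented node
  have hIj : (I.map (IsLocalRing.residue (v.adicCompletionIntegers K))).map j =
      singularModel x₀ y₀ α₁ α₂ := by
    rw [← hV, map_map]
    have hcoef : ∀ (f : v.adicCompletionIntegers K) (g : w.integer),
        (g : AlgebraicClosure (v.adicCompletion K)) =
          algebraMap (v.adicCompletion K) (AlgebraicClosure (v.adicCompletion K))
            (algebraMap (v.adicCompletionIntegers K) (v.adicCompletion K) f) →
        (j.comp (IsLocalRing.residue (v.adicCompletionIntegers K))) f =
          IsLocalRing.residue w.integer g := by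
      intro f g hfg
      rw [RingHom.comp_apply, hj f (hle f)]
      exact congrArg _ (Subtype.ext hfg.symm)
    have e₁ := congrArg WeierstrassCurve.a₁ hW₀I
    have e₂ := congrArg WeierstrassCurve.a₂ hW₀I
    have e₃ := congrArg WeierstrassCurve.a₃ hW₀I
    have e₄ := congrArg WeierstrassCurve.a₄ hW₀I
    have e₆ := congrArg WeierstrassCurve.a₆ hW₀I
    simp only [map_a₁, map_a₂, map_a₃, map_a₄, map_a₆, RingHom.comp_apply] at e₁ e₂ e₃ e₄ e₆
    ext
    · rw [map_a₁, map_a₁]; exact hcoef _ _ e₁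
    · rw [map_a₂, map_a₂]; exact hcoef _ _ e₂
    · rw [map_a₃, map_a₃]; exact hcoef _ _ e₃
    · rw [map_a₄, map_a₄]; exact hcoef _ _ e₄
    · rw [map_a₆, map_a₆]; exact hcoef _ _ e₆
  -- ### the reduction datum on `E(K̄)` (independent of `σ`)
  set 𝔓 := v.primeBelow ι 𝔐 with h𝔓def
  have h𝔓mem : 𝔓 ∈ v.primesAbove := primeBelow_mem_primesAbove h𝔐
  haveI : 𝔓.IsPrime := h𝔓mem.1
  have hℓ𝔓 : (ℓ : absIntegers (𝓞 K) K) ∉ 𝔓 := absIntegers.natCast_notMem_of_mem_primesAbove hℓ h𝔓mem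
  set H := 𝔓.inertia (absoluteGaloisGroup K) with hH
  let G : geomPoints W →+ (W₀.baseChange (AlgebraicClosure (v.adicCompletion K))).toAffine.Point :=
    (Affine.Point.congrEquiv hW₀).toAddMonoidHom.comp (Φ.toAddMonoidHom.comp (pointsMapOfEmb W ι))
  have hGapply : ∀ P : geomPoints W,
      G P = Affine.Point.congrEquiv hW₀ (Φ (pointsMapOfEmb W ι P)) := fun _ ↦ rfl
  have hGinj : Function.Injective G := fun P Q hPQ ↦ by
    rw [hGapply, hGapply] at hPQ
    exact pointsMapOfEmb_injective W ι (Φ.injective ((Affine.Point.congrEquiv hW₀).injective hPQ))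
  -- local inertia restricts into `I_𝔓`
  have hfixloc : ∀ P : geomPoints W, (∀ τ ∈ H, τ • P = P) →
      ∀ σ ∈ 𝔐.inertia (absoluteGaloisGroup (v.adicCompletion K)),
        Affine.Point.map ((absoluteGaloisGroup.toAlgEquiv _ σ :
            AlgebraicClosure (v.adicCompletion K) ≃ₐ[v.adicCompletion K]
              AlgebraicClosure (v.adicCompletion K)) :
            AlgebraicClosure (v.adicCompletion K) →ₐ[v.adicCompletion K]
              AlgebraicClosure (v.adicCompletion K)) (Φ (pointsMapOfEmb W ι P)) =
          Φ (pointsMapOfEmb W ι P) := by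
    intro P hP σ hσ
    rw [← hΦ σ, ← pointsMapOfEmb_smul]
    congr 2
    exact hP _ (resGalOfEmb_mem_inertia_primeBelow v ι 𝔐 hσ)
  let A' : AddSubgroup (geomPoints W) :=
    FixedPoints.addSubgroup H (geomPoints W) ⊓
      (W₀.nonsingularReductionSubgroup hv0).comap G
  have hA'mem : ∀ P : geomPoints W, P ∈ A' ↔
      (∀ τ ∈ H, τ • P = P) ∧ W₀.HasNonsingularReduction (G P) := by
    intro P
    rw [AddSubgroup.mem_inf, FixedPoints.mem_addSubgroup, AddSubgroup.mem_comap,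
      mem_nonsingularReductionSubgroup_iff]
    simp only [Subtype.forall, Subgroup.mk_smul]
  have hcA' : ∀ P : geomPoints W, (∀ τ ∈ H, τ • P = P) → c • P ∈ A' := by
    intro P hP
    rw [hA'mem]
    refine ⟨fun τ hτ ↦ by rw [smul_comm, hP τ hτ], ?_⟩
    rw [map_nsmul, hGapply, ← map_nsmul]
    exact hcE₀ _ (hfixloc P hP)
  let r' : A' →+ Additive (IsLocalRing.ResidueField w.integer)ˣ :=
    r.comp ((G.comp A'.subtype).codRestrict (W₀.nonsingularReductionSubgroup hv0) (fun P ↦ P.2.2))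
  have hr'apply : ∀ P : A', r' P = r ⟨G P, P.2.2⟩ := fun _ ↦ rfl
  -- the kernel of `r'` has no `ℓ`-torsion (`E₁[ℓ] = 0`)
  have hℓw : w ((ℓ : ℤ) : AlgebraicClosure (v.adicCompletion K)) = 1 :=
    spectralValuation_intCast_eq_one hw (n := (ℓ : ℤ)) (by simpa using hℓ)
  have htf : ∀ P : A', r' P = 0 → ℓ • P = 0 → P = 0 := by
    intro P hrP hℓP
    have h0 : W₀.ReducesToZero (G P) := (hr0 ⟨G P, P.2.2⟩).mp hrP
    have hℓG : (ℓ : ℤ) • G P = 0 := by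
      rw [natCast_zsmul, ← map_nsmul, ← AddSubgroup.coe_nsmul, hℓP, AddSubgroup.coe_zero, map_zero]
    have hG0 : G P = 0 := h0.eq_zero_of_zsmul_eq_zero W₀ hℓw hℓG
    have hP0 : (P : geomPoints W) = 0 := hGinj (by rw [hG0, map_zero])
    exact Subtype.ext hP0
  -- the residue map of `\bar ℤ_K` at `𝔓`
  obtain ⟨φ, hφinj, hφ⟩ := v.exists_ringHom_quotient_primeBelow hw ι h𝔐
  have hleK : ∀ b : absIntegers (𝓞 K) K, w (ι b) ≤ 1 := fun b ↦
    (mem_localAbsIntegers_iff_spectralValuation hw).mp (absIntegersToLocal v ι b).2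
  have hPmem : ∀ P : A', W₀.HasNonsingularReduction
      (Affine.Point.congrEquiv hW₀ (Φ (pointsMapOfEmb W ι P))) := fun P ↦ P.2.2
  refine ⟨c, hc, fun σD n P hP hPn ↦ ?_⟩
  -- ### an element of `D_𝔓`, its local lift and the residue maps
  set σ₀ : absoluteGaloisGroup K := (σD : absoluteGaloisGroup K) with hσ₀def
  have hσ₀D : σ₀ • 𝔓 = 𝔓 := (Ideal.mem_decompositionSubgroup_iff).mp σD.2
  obtain ⟨σv, hισ₀⟩ := exists_absoluteGaloisGroup_apply_eq_of_smul_primeBelow_eq ι h𝔐 hσ₀D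
  have hres₀ : resGalOfEmb ι σv = σ₀ := resGalOfEmb_eq_of_apply_eq ι hισ₀
  set σvA : AlgebraicClosure (v.adicCompletion K) →ₐ[v.adicCompletion K]
      AlgebraicClosure (v.adicCompletion K) :=
    ((absoluteGaloisGroup.toAlgEquiv _ σv :
      AlgebraicClosure (v.adicCompletion K) ≃ₐ[v.adicCompletion K]
        AlgebraicClosure (v.adicCompletion K)) :
      AlgebraicClosure (v.adicCompletion K) →ₐ[v.adicCompletion K]
        AlgebraicClosure (v.adicCompletion K)) with hσvA
  have hσvA_apply : ∀ z, σvA z = σv • z := fun _ ↦ rfl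
  have hσ₁ : ∀ z, w (σvA z) = w z := fun z ↦ by rw [hσvA_apply]; exact spectralValuation_smul hw σv z
  obtain ⟨σk, hσres, hstable, -, -, hbranch⟩ :=
    W₀.exists_residueMap_nodeReduction_smul hW₀ σvA hσ₁ hV r hr0 hrf
  -- `σ̄_v` fixes the image of `k_v` …
  have hgj : ∀ t, σk (j t) = j t := by
    intro t
    obtain ⟨a, rfl⟩ := IsLocalRing.residue_surjective t
    have hσa : w (σvA (algebraMap (v.adicCompletion K) (AlgebraicClosure (v.adicCompletion K))
        (algebraMap (v.adicCompletionIntegers K) (v.adicCompletion K) a))) ≤ 1 := by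
      rw [hσ₁]; exact hle a
    rw [hj a (hle a), hσres _ (hle a) hσa]
    congr 1
    apply Subtype.ext
    change σvA _ = _
    exact σvA.commutes _
  -- … hence, the reduction being split, the tangent slopes: `r` is `σ`-equivariant
  obtain ⟨h₁, -⟩ :=
    apply_slopes_eq_of_splits I j σk hIj hc₄O hgj hsplit'.splitMultiplicativeReduction
  have hequiv : ∀ (Q : ((W.localMinimalModel v).baseChange
        (AlgebraicClosure (v.adicCompletion K))).toAffine.Point)
      (hQ : W₀.HasNonsingularReduction (Affine.Point.congrEquiv hW₀ Q))
      (hσQ : W₀.HasNonsingularReduction (Affine.Point.congrEquiv hW₀ (Affine.Point.map σvA Q))),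
      ((r ⟨_, hσQ⟩).toMul : IsLocalRing.ResidueField w.integer) =
        σk ((r ⟨_, hQ⟩).toMul : IsLocalRing.ResidueField w.integer) := by
    rcases hbranch with ⟨-, -, hb⟩ | ⟨hb₁, -, -⟩
    · exact hb
    · exact (hα (h₁.symm.trans hb₁)).elim
  -- ### `σ` on the datum
  have hGσ : ∀ P : geomPoints W, G (σ₀ • P) =
      Affine.Point.congrEquiv hW₀ (Affine.Point.map σvA (Φ (pointsMapOfEmb W ι P))) := by
    intro P
    have h1 := pointsMapOfEmb_smul (W := W) (ι := ι) σv P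
    rw [hres₀] at h1
    rw [hGapply, h1, hΦ σv]
  -- `σ₀` normalises `I_𝔓`
  have h𝔓inv : σ₀⁻¹ • 𝔓 = 𝔓 := by
    conv_lhs => rw [← hσ₀D]
    rw [inv_smul_smul]
  have hconj : ∀ τ ∈ H, σ₀⁻¹ * τ * σ₀ ∈ H := by
    intro τ hτ x
    have h1 : τ • (σ₀ • x) - σ₀ • x ∈ 𝔓 := hτ (σ₀ • x)
    have h2 : σ₀⁻¹ • (τ • (σ₀ • x) - σ₀ • x) ∈ σ₀⁻¹ • 𝔓 :=
      Ideal.smul_mem_pointwise_smul_iff.mpr h1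
    rw [h𝔓inv, smul_sub, inv_smul_smul, smul_smul, smul_smul] at h2
    exact h2
  have hA'σ : ∀ P : geomPoints W, P ∈ A' → σ₀ • P ∈ A' := by
    intro P hP
    rw [hA'mem] at hP ⊢
    refine ⟨fun τ hτ ↦ ?_, ?_⟩
    · have := hP.1 _ (hconj τ hτ)
      calc τ • σ₀ • P = σ₀ • ((σ₀⁻¹ * τ * σ₀) • P) := by
            rw [mul_smul, mul_smul, smul_inv_smul]
        _ = σ₀ • P := by rw [this]
    · rw [hGσ]
      exact hstable _ (by rw [← hGapply]; exact hP.2)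
  -- the residue map intertwines `σ₀` and `σ̄_v`
  have hφσ : ∀ x : absIntegers (𝓞 K) K,
      φ (Ideal.Quotient.mk 𝔓 (σ₀ • x)) = σk (φ (Ideal.Quotient.mk 𝔓 x)) := by
    intro x
    have hσx : w (σvA (ι x)) ≤ 1 := by rw [hσ₁]; exact hleK x
    rw [hφ x (hleK x), hφ (σ₀ • x) (hleK _), hσres (ι x) (hleK x) hσx]
    congr 1
    apply Subtype.ext
    change ι ((σ₀ • x : absIntegers (𝓞 K) K) : AlgebraicClosure K) = σvA (ι x)
    rw [integralClosure.coe_smul, hισ₀, hσvA_apply]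
  -- values of `r'` on `σ₀`-moved points
  have hr'σ : ∀ (P : A') (hσmem : W₀.HasNonsingularReduction
      (Affine.Point.congrEquiv hW₀ (Affine.Point.map σvA (Φ (pointsMapOfEmb W ι P))))),
      r' ⟨σ₀ • (P : geomPoints W), hA'σ P P.2⟩ = r ⟨_, hσmem⟩ := by
    intro P hσmem
    rw [hr'apply]
    exact congrArg r (Subtype.ext (hGσ P))
  have hσPmem : ∀ P : A', W₀.HasNonsingularReduction
      (Affine.Point.congrEquiv hW₀ (Affine.Point.map σvA (Φ (pointsMapOfEmb W ι P)))) :=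
    fun P ↦ hstable _ (hPmem P)
  -- ### conclusion: the split datum shape
  refine smul_nsmul_eq_cyclotomicCharacter_smul_of_reduction ℓ hℓ𝔓 φ hφinj A' hA'σ hcA' r'
    (fun Q x hx ↦ ?_) htf n P hP hPn
  rw [hr'σ Q (hσPmem Q), hequiv _ (hPmem Q) (hσPmem Q), hφσ, hx]
  rfl

/-- **The same at every prime `𝔓 ∣ v`** (every such prime is cut out by an embedding: `Γ_K` is
transitive on the primes above `v`, `exists_smul_eq_of_mem_primesAbove_holds`, and
`𝔓_{ι∘τ,𝔐} = τ⁻¹ • 𝔓_{ι,𝔐}`, `primeBelow_comp`).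
[cite: SerreTate1968, §1 Lemma 1 and Lemma 2 (p. 495)]
[cite: SilvermanATAEC1994, Exercise 5.13(a),(b) (PDF p. 416)] -/
theorem smul_nsmul_torsion_of_hasSplitMultiplicativeReductionAt_at [W.IsElliptic]
    (hℓ : (ℓ : 𝓞 K) ∉ v.asIdeal) (hv : W.HasSplitMultiplicativeReductionAt v)
    {𝔓 : Ideal (absIntegers (𝓞 K) K)} (h𝔓 : 𝔓 ∈ v.primesAbove) :
    ∃ c : ℕ, c ≠ 0 ∧
      ∀ (σ : 𝔓.decompositionSubgroup (absoluteGaloisGroup K)) (n : ℕ) (P : geomPoints W),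
        (∀ τ ∈ 𝔓.inertia (absoluteGaloisGroup K), τ • P = P) → ℓ ^ n • P = 0 →
        (σ : absoluteGaloisGroup K) • (c • P) =
          (((GaloisRep.cyclotomicCharacter K ℓ (σ : absoluteGaloisGroup K) : ℤ_[ℓ]ˣ) :
            ℤ_[ℓ]).toZModPow n).val • (c • P) := by
  obtain ⟨𝔐, h𝔐⟩ := v.localPrimesAbove_nonempty
  obtain ⟨g, hg⟩ := HeightOneSpectrum.exists_smul_eq_of_mem_primesAbove_holds
    (HeightOneSpectrum.primeBelow_mem_primesAbove
      (ι := closureEmb (K := K) (v.adicCompletion K)) h𝔐) h𝔓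
  have h1 : 𝔓 = v.primeBelow ((closureEmb (K := K) (v.adicCompletion K)).comp
      ((show AlgebraicClosure K ≃ₐ[K] AlgebraicClosure K from g⁻¹) :
        AlgebraicClosure K →ₐ[K] AlgebraicClosure K)) 𝔐 := by
    rw [HeightOneSpectrum.primeBelow_comp, ← hg]
    exact congrArg (· • _) (inv_inv g).symm
  subst h1
  exact W.smul_nsmul_torsion_of_hasSplitMultiplicativeReductionAt_primeBelow ℓ hℓ hv _ h𝔐

/-! ## The discharge -/

/-- **The named fact `serreTate_smul_torsion_of_hasSplitMultiplicativeReductionAt W ℓ`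
(`HasseWeilAbelianEulerFactorTorsion`: Serre–Tate §1 Lemmas 1–2 + split torus, for the whole
decomposition group `D_𝔓`) is a theorem.**
[cite: SerreTate1968, §1 Lemma 1 and Lemma 2 (p. 495)]
[cite: SilvermanAEC2009, Prop. III.2.5(a), Exercise 3.5(a)(i), Thm. VII.6.1 (PDF pp. 59, 97, 177)] -/
theorem serreTate_smul_torsion_of_hasSplitMultiplicativeReductionAt_holds :
    W.serreTate_smul_torsion_of_hasSplitMultiplicativeReductionAt ℓ := by
  intro _ v hℓ hv 𝔓 h𝔓
  exact W.smul_nsmul_torsion_of_hasSplitMultiplicativeReductionAt_at ℓ hℓ hv h𝔓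

end WeierstrassCurve

end
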